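import Summits.AnomalousDissipation.AnomalousDissipation.Theorems.SolenoidalFractalHomogenisationLagrangianStepCellChainModes
import Mathlib.Analysis.InnerProductSpace.Calculus
import HarnessLib

/-!
# K1L_D `LagrangianRenormalisationStepDesign` (stmt-AnomalousDissipation-27980), `stub_cellLawV0_IS` V0 (and W7 S1a):
# the chain of a weak solution of the flat tensor cell problem is a CLASSICAL `C¹` ODE system on `(0,T)` (helper;
# `--supports stmt-AnomalousDissipation-27980`)

Summits-side helper file of route `SolenoidalFractalHomogenisation` (prover seat `ad-k1l-cellLawV-w1` g5).  Everything proved; no definitions,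
no named facts, no sorry.  Setting: `h : Torus.IsWeakTensorPassiveVectorOn 0 T 𝔹 (W₁.cell n) F u`, `F ∈ L¹`, `modeRep … k` the continuous
representative of the mode `k` (`…CellChainDefs`).

`…CellChainModes` proves the chain ODE as an a.e. derivative, `HasDerivAt (modeRep … k) (modeRHS … k t) t` for a.e. `t ∈ (0,T)`, where the
integrand `modeRHS` is read on the a.e.-defined Fourier coefficients `û(t)`.  Here the integrand is replaced by its CONTINUOUS version read on the
representatives — the two agree a.e. on `(0,T)` by `ae_forall_eq_modeRep` — so that `modeRep … k t = P_k F̂(k) + ∫₀ᵗ (continuous)` on `[0,T]`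
(`modeRep_eq_integral_rep`) and the first fundamental theorem of calculus gives the derivative at EVERY interior time:

* `continuousOn_repRHS` — the representative right-hand side
  `−4π² P_k T_{𝔹ᵀ}(k) modeRep(k,t) − Σⱼ linkCoeffⱼ(k,t) • P_k (aⱼ • modeRep(k − Kⱼ,t) + a′ⱼ • modeRep(k + Kⱼ,t))` is continuous on `[0,T]`;
* **`hasDerivAt_modeRep`** — `∀ t ∈ Ioo 0 T, HasDerivAt (modeRep … k) (that expression at t) t` (every mode, every interior time: the chain is
  a classical `C¹` system of ODEs on `(0,T)`, coupled along `k ↦ k ± Kⱼ`);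
* `hasDerivWithinAt_modeRep` — the one-sided version `HasDerivWithinAt … (Icc 0 T) t` at every `t ∈ [0,T]` (slot windows starting at `t = 0`);
* `hasDerivAt_norm_sq_modeRep`, `hasDerivAt_re_inner_modeRep` — the classical derivatives of `‖modeRep k‖²` and of `Re⟪modeRep k, modeRep k'⟫`.

Purpose: the ODE lemmas of `Literature/Analysis/ODE/*` (slaving `SlowColumnSlaving*`, averaging `LinearPeriodicAveraging`, the slow-graph lever
`…CellLawVSlowGraph*`) are stated for trajectories with derivatives EVERYWHERE on a window; after this file they apply to every finite sub-chain of
THE weak solution with no absolute-continuity bookkeeping.  NOT a proof of any registered stub, of the crux, or of anomalous dissipation; rung F-D1.A0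
infrastructure.
-/

set_option linter.dupNamespace false

noncomputable section

namespace Summit.AnomalousDissipation.AnomalousDissipation.Theorems.SolenoidalFractalHomogenisation.LagrangianStep.CellChain

open Set MeasureTheory Filter Topology Function Complex UnitAddTorus
open scoped InnerProductSpace ComplexConjugate
open Literature.Analysis Literature.Analysis.FunctionSpaces Literature.Analysis.FunctionSpaces.Torus
open Literature.Analysis.FluidPDE Literature.Analysis.FluidPDE.Torus Literature.Analysis.FluidPDE.LatticeShear

variable {k₀ : ℕ}

/-! ## §1 Continuity of the representative right-hand side -/

/-- **The representative right-hand side is continuous on `[0,T]`** (the representatives are continuous there, the link coefficients are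
continuous, `P_k` and `T_{𝔹ᵀ}(k)` are linear). [cite: Temam1984, Ch. III §1.1] -/
theorem continuousOn_repRHS (W₁ : LatticeWord k₀) (n : ℕ) {T : ℝ} (hT : 0 ≤ T) {𝔹 : Torus.Visc4 (Fin 3)}
    {F : UnitAddTorus (Fin 3) → EuclideanSpace ℝ (Fin 3)} {u : ℝ → UnitAddTorus (Fin 3) → EuclideanSpace ℝ (Fin 3)}
    (h : Torus.IsWeakTensorPassiveVectorOn 0 T 𝔹 (W₁.cell n) F u) (k : Fin 3 → ℤ) :
    ContinuousOn (fun t =>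
      -(((4 * Real.pi ^ 2 : ℝ) : ℂ) • transversalProj k (Torus.symbT (Torus.majorTranspose 𝔹) k (modeRep W₁ n 𝔹 F u k t))) -
        ∑ j, linkCoeff W₁ n k j t • transversalProj k
          ((Complex.exp ((W₁.phase j).φ * Complex.I) * (1 / (2 * ((2 * Real.pi * ‖latticeVec (W₁.phase j).m‖ : ℝ) : ℂ) * Complex.I))) •
              modeRep W₁ n 𝔹 F u (k - fun i => (W₁.phase j).m i * n) t +
            (starRingEnd ℂ (Complex.exp ((W₁.phase j).φ * Complex.I)) *
                (-(1 / (2 * ((2 * Real.pi * ‖latticeVec (W₁.phase j).m‖ : ℝ) : ℂ) * Complex.I)))) •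
              modeRep W₁ n 𝔹 F u (k + fun i => (W₁.phase j).m i * n) t)) (Icc 0 T) := by
  have hrep : ∀ k', ContinuousOn (modeRep W₁ n 𝔹 F u k') (Icc 0 T) := fun k' => continuousOn_modeRep W₁ n hT h k'
  -- the viscous term
  have h1 : ContinuousOn (fun t => Torus.symbT (Torus.majorTranspose 𝔹) k (modeRep W₁ n 𝔹 F u k t)) (Icc 0 T) :=
    ((symbTL (Torus.majorTranspose 𝔹) k).continuous.comp_continuousOn (hrep k)).congr fun t _ => rfl
  have h2 : ContinuousOn (fun t => transversalProj k (Torus.symbT (Torus.majorTranspose 𝔹) k (modeRep W₁ n 𝔹 F u k t))) (Icc 0 T) :=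
    ((transversalProj k).continuous.comp_continuousOn h1).congr fun t _ => rfl
  have h3 : ContinuousOn (fun t =>
      -(((4 * Real.pi ^ 2 : ℝ) : ℂ) • transversalProj k (Torus.symbT (Torus.majorTranspose 𝔹) k (modeRep W₁ n 𝔹 F u k t)))) (Icc 0 T) :=
    (h2.const_smul (((4 * Real.pi ^ 2 : ℝ) : ℂ))).neg
  -- the link terms
  have h4 : ∀ j : Fin k₀, ContinuousOn (fun t => linkCoeff W₁ n k j t • transversalProj k
          ((Complex.exp ((W₁.phase j).φ * Complex.I) * (1 / (2 * ((2 * Real.pi * ‖latticeVec (W₁.phase j).m‖ : ℝ) : ℂ) * Complex.I))) •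
              modeRep W₁ n 𝔹 F u (k - fun i => (W₁.phase j).m i * n) t +
            (starRingEnd ℂ (Complex.exp ((W₁.phase j).φ * Complex.I)) *
                (-(1 / (2 * ((2 * Real.pi * ‖latticeVec (W₁.phase j).m‖ : ℝ) : ℂ) * Complex.I)))) •
              modeRep W₁ n 𝔹 F u (k + fun i => (W₁.phase j).m i * n) t)) (Icc 0 T) := by
    intro j
    have ha : ContinuousOn (fun t =>
        (Complex.exp ((W₁.phase j).φ * Complex.I) * (1 / (2 * ((2 * Real.pi * ‖latticeVec (W₁.phase j).m‖ : ℝ) : ℂ) * Complex.I))) •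
              modeRep W₁ n 𝔹 F u (k - fun i => (W₁.phase j).m i * n) t +
            (starRingEnd ℂ (Complex.exp ((W₁.phase j).φ * Complex.I)) *
                (-(1 / (2 * ((2 * Real.pi * ‖latticeVec (W₁.phase j).m‖ : ℝ) : ℂ) * Complex.I)))) •
              modeRep W₁ n 𝔹 F u (k + fun i => (W₁.phase j).m i * n) t) (Icc 0 T) :=
      ((hrep (k - fun i => (W₁.phase j).m i * n)).const_smul
        (Complex.exp ((W₁.phase j).φ * Complex.I) * (1 / (2 * ((2 * Real.pi * ‖latticeVec (W₁.phase j).m‖ : ℝ) : ℂ) * Complex.I)))).add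
        ((hrep (k + fun i => (W₁.phase j).m i * n)).const_smul
          (starRingEnd ℂ (Complex.exp ((W₁.phase j).φ * Complex.I)) *
                (-(1 / (2 * ((2 * Real.pi * ‖latticeVec (W₁.phase j).m‖ : ℝ) : ℂ) * Complex.I)))))
    have hb : ContinuousOn (fun t => transversalProj k
        ((Complex.exp ((W₁.phase j).φ * Complex.I) * (1 / (2 * ((2 * Real.pi * ‖latticeVec (W₁.phase j).m‖ : ℝ) : ℂ) * Complex.I))) •
              modeRep W₁ n 𝔹 F u (k - fun i => (W₁.phase j).m i * n) t +
            (starRingEnd ℂ (Complex.exp ((W₁.phase j).φ * Complex.I)) *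
                (-(1 / (2 * ((2 * Real.pi * ‖latticeVec (W₁.phase j).m‖ : ℝ) : ℂ) * Complex.I)))) •
              modeRep W₁ n 𝔹 F u (k + fun i => (W₁.phase j).m i * n) t)) (Icc 0 T) :=
      ((transversalProj k).continuous.comp_continuousOn ha).congr fun t _ => rfl
    exact (continuous_linkCoeff W₁ n k j).continuousOn.smul hb
  have h5 := continuousOn_finsetSum (Finset.univ : Finset (Fin k₀)) fun j _ => h4 j
  exact h3.sub h5

/-! ## §2 The representative as the primitive of a continuous function; classical derivatives -/

/-- On `[0,T]` the primitive of the a.e. integrand `modeRHS` equals the primitive of the representative right-hand side (the two integrands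
agree a.e. on `(0,T)`: all modes coincide with their representatives there, `ae_forall_eq_modeRep`). [cite: Temam1984, Ch. III §1.1] -/
theorem intervalIntegral_modeRHS_eq_rep (W₁ : LatticeWord k₀) (n : ℕ) {T : ℝ} (hT : 0 ≤ T) {𝔹 : Torus.Visc4 (Fin 3)}
    {F : UnitAddTorus (Fin 3) → EuclideanSpace ℝ (Fin 3)} {u : ℝ → UnitAddTorus (Fin 3) → EuclideanSpace ℝ (Fin 3)}
    (h : Torus.IsWeakTensorPassiveVectorOn 0 T 𝔹 (W₁.cell n) F u) (hF : Integrable F volume) (k : Fin 3 → ℤ)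
    {t : ℝ} (ht : t ∈ Icc 0 T) :
    ∫ τ in (0:ℝ)..t, modeRHS W₁ n 𝔹 u k τ = ∫ τ in (0:ℝ)..t,
      (-(((4 * Real.pi ^ 2 : ℝ) : ℂ) • transversalProj k (Torus.symbT (Torus.majorTranspose 𝔹) k (modeRep W₁ n 𝔹 F u k τ))) -
        ∑ j, linkCoeff W₁ n k j τ • transversalProj k
          ((Complex.exp ((W₁.phase j).φ * Complex.I) * (1 / (2 * ((2 * Real.pi * ‖latticeVec (W₁.phase j).m‖ : ℝ) : ℂ) * Complex.I))) •
              modeRep W₁ n 𝔹 F u (k - fun i => (W₁.phase j).m i * n) τ +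
            (starRingEnd ℂ (Complex.exp ((W₁.phase j).φ * Complex.I)) *
                (-(1 / (2 * ((2 * Real.pi * ‖latticeVec (W₁.phase j).m‖ : ℝ) : ℂ) * Complex.I)))) •
              modeRep W₁ n 𝔹 F u (k + fun i => (W₁.phase j).m i * n) τ)) := by
  refine intervalIntegral.integral_congr_ae ?_
  have hae : ∀ᵐ τ ∂(volume : Measure ℝ), τ ∈ Ioo 0 T →
      ∀ k', mFourierCoeff (EuclideanSpace.complexify ∘ u τ) k' = modeRep W₁ n 𝔹 F u k' τ :=
    (ae_restrict_iff' measurableSet_Ioo).1 (ae_forall_eq_modeRep W₁ n hT h hF)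
  have hT' : ∀ᵐ s ∂(volume : Measure ℝ), s ≠ T := by
    have : ({T}ᶜ : Set ℝ) ∈ ae (volume : Measure ℝ) := compl_mem_ae_iff.2 (measure_singleton _)
    filter_upwards [this] with s hs
    simpa using hs
  filter_upwards [hae, hT'] with τ hτ hτT hτI
  rw [uIoc_of_le ht.1] at hτI
  have hτ' : τ ∈ Ioo 0 T := ⟨hτI.1, lt_of_le_of_ne (hτI.2.trans ht.2) hτT⟩
  exact modeRHS_eq_of_forall_eq W₁ n 𝔹 F u (hτ hτ') k

/-- **The representative is the primitive of its CONTINUOUS right-hand side**: on `[0,T]`,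
`modeRep … k t = P_k F̂(k) + ∫₀ᵗ (−4π² P_k T_{𝔹ᵀ}(k) modeRep(k) − Σⱼ linkCoeffⱼ • P_k (aⱼ • modeRep(k−Kⱼ) + a′ⱼ • modeRep(k+Kⱼ)))`.
[cite: Temam1984, Ch. III §1.1] -/
theorem modeRep_eq_integral_rep (W₁ : LatticeWord k₀) (n : ℕ) {T : ℝ} (hT : 0 ≤ T) {𝔹 : Torus.Visc4 (Fin 3)}
    {F : UnitAddTorus (Fin 3) → EuclideanSpace ℝ (Fin 3)} {u : ℝ → UnitAddTorus (Fin 3) → EuclideanSpace ℝ (Fin 3)}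
    (h : Torus.IsWeakTensorPassiveVectorOn 0 T 𝔹 (W₁.cell n) F u) (hF : Integrable F volume) (k : Fin 3 → ℤ)
    {t : ℝ} (ht : t ∈ Icc 0 T) :
    modeRep W₁ n 𝔹 F u k t = transversalProj k (mFourierCoeff (EuclideanSpace.complexify ∘ F) k) + ∫ τ in (0:ℝ)..t,
      (-(((4 * Real.pi ^ 2 : ℝ) : ℂ) • transversalProj k (Torus.symbT (Torus.majorTranspose 𝔹) k (modeRep W₁ n 𝔹 F u k τ))) -
        ∑ j, linkCoeff W₁ n k j τ • transversalProj k
          ((Complex.exp ((W₁.phase j).φ * Complex.I) * (1 / (2 * ((2 * Real.pi * ‖latticeVec (W₁.phase j).m‖ : ℝ) : ℂ) * Complex.I))) •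
              modeRep W₁ n 𝔹 F u (k - fun i => (W₁.phase j).m i * n) τ +
            (starRingEnd ℂ (Complex.exp ((W₁.phase j).φ * Complex.I)) *
                (-(1 / (2 * ((2 * Real.pi * ‖latticeVec (W₁.phase j).m‖ : ℝ) : ℂ) * Complex.I)))) •
              modeRep W₁ n 𝔹 F u (k + fun i => (W₁.phase j).m i * n) τ)) := by
  rw [modeRep_def, intervalIntegral_modeRHS_eq_rep W₁ n hT h hF k ht]

/-- **THE CHAIN IS A CLASSICAL ODE SYSTEM ON `(0,T)`**: at EVERY interior time `t ∈ (0,T)` and for every mode `k`, the representative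
`modeRep … k` is differentiable with derivative the representative right-hand side at `t` (first fundamental theorem of calculus for the
continuous integrand of `modeRep_eq_integral_rep`). [cite: Temam1984, Ch. III §1.1] [cite: MeshalkinSinai1961, pp. 1700–1705] -/
theorem hasDerivAt_modeRep (W₁ : LatticeWord k₀) (n : ℕ) {T : ℝ} {𝔹 : Torus.Visc4 (Fin 3)}
    {F : UnitAddTorus (Fin 3) → EuclideanSpace ℝ (Fin 3)} {u : ℝ → UnitAddTorus (Fin 3) → EuclideanSpace ℝ (Fin 3)}
    (h : Torus.IsWeakTensorPassiveVectorOn 0 T 𝔹 (W₁.cell n) F u) (hF : Integrable F volume) (k : Fin 3 → ℤ)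
    {t : ℝ} (ht : t ∈ Ioo 0 T) :
    HasDerivAt (modeRep W₁ n 𝔹 F u k)
      (-(((4 * Real.pi ^ 2 : ℝ) : ℂ) • transversalProj k (Torus.symbT (Torus.majorTranspose 𝔹) k (modeRep W₁ n 𝔹 F u k t))) -
        ∑ j, linkCoeff W₁ n k j t • transversalProj k
          ((Complex.exp ((W₁.phase j).φ * Complex.I) * (1 / (2 * ((2 * Real.pi * ‖latticeVec (W₁.phase j).m‖ : ℝ) : ℂ) * Complex.I))) •
              modeRep W₁ n 𝔹 F u (k - fun i => (W₁.phase j).m i * n) t +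
            (starRingEnd ℂ (Complex.exp ((W₁.phase j).φ * Complex.I)) *
                (-(1 / (2 * ((2 * Real.pi * ‖latticeVec (W₁.phase j).m‖ : ℝ) : ℂ) * Complex.I)))) •
              modeRep W₁ n 𝔹 F u (k + fun i => (W₁.phase j).m i * n) t)) t := by
  have hT : 0 ≤ T := (ht.1.trans ht.2).le
  -- the continuous integrand
  set R : ℝ → EuclideanSpace ℂ (Fin 3) := fun τ =>
      (-(((4 * Real.pi ^ 2 : ℝ) : ℂ) • transversalProj k (Torus.symbT (Torus.majorTranspose 𝔹) k (modeRep W₁ n 𝔹 F u k τ))) -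
        ∑ j, linkCoeff W₁ n k j τ • transversalProj k
          ((Complex.exp ((W₁.phase j).φ * Complex.I) * (1 / (2 * ((2 * Real.pi * ‖latticeVec (W₁.phase j).m‖ : ℝ) : ℂ) * Complex.I))) •
              modeRep W₁ n 𝔹 F u (k - fun i => (W₁.phase j).m i * n) τ +
            (starRingEnd ℂ (Complex.exp ((W₁.phase j).φ * Complex.I)) *
                (-(1 / (2 * ((2 * Real.pi * ‖latticeVec (W₁.phase j).m‖ : ℝ) : ℂ) * Complex.I)))) •
              modeRep W₁ n 𝔹 F u (k + fun i => (W₁.phase j).m i * n) τ)) with hR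
  have hRc : ContinuousOn R (Icc 0 T) := continuousOn_repRHS W₁ n hT h k
  -- the primitive `G s = P_k F̂(k) + ∫₀ˢ R` has derivative `R t` at the interior point `t`
  have hint : IntervalIntegrable R volume 0 t :=
    (hRc.mono (by rw [uIcc_of_le ht.1.le]; exact Icc_subset_Icc_right ht.2.le)).intervalIntegrable
  have hmeas : StronglyMeasurableAtFilter R (𝓝 t) volume :=
    (hRc.mono Ioo_subset_Icc_self).stronglyMeasurableAtFilter isOpen_Ioo t ht
  have hcont : ContinuousAt R t := hRc.continuousAt (Icc_mem_nhds ht.1 ht.2)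
  have hG : HasDerivAt (fun s => transversalProj k (mFourierCoeff (EuclideanSpace.complexify ∘ F) k) + ∫ τ in (0:ℝ)..s, R τ) (R t) t :=
    (intervalIntegral.integral_hasDerivAt_right hint hmeas hcont).const_add _
  -- `modeRep` agrees with `G` on the neighbourhood `(0,T)` of `t`
  have heq : modeRep W₁ n 𝔹 F u k =ᶠ[𝓝 t]
      fun s => transversalProj k (mFourierCoeff (EuclideanSpace.complexify ∘ F) k) + ∫ τ in (0:ℝ)..s, R τ := by
    filter_upwards [Ioo_mem_nhds ht.1 ht.2] with s hs
    exact modeRep_eq_integral_rep W₁ n hT h hF k (Ioo_subset_Icc_self hs)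
  exact hG.congr_of_eventuallyEq heq

/-- **One-sided version at every `t ∈ [0,T]`**: `HasDerivWithinAt (modeRep … k) (representative right-hand side at t) (Icc 0 T) t` — the
form the window lemmas of `Literature/Analysis/ODE/*` consume (`HasDerivWithinAt … (Icc t₀ t₁) t`, by `.mono`), including slot windows that
start at `t = 0`. [cite: Temam1984, Ch. III §1.1] -/
theorem hasDerivWithinAt_modeRep (W₁ : LatticeWord k₀) (n : ℕ) {T : ℝ} {𝔹 : Torus.Visc4 (Fin 3)}
    {F : UnitAddTorus (Fin 3) → EuclideanSpace ℝ (Fin 3)} {u : ℝ → UnitAddTorus (Fin 3) → EuclideanSpace ℝ (Fin 3)}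
    (h : Torus.IsWeakTensorPassiveVectorOn 0 T 𝔹 (W₁.cell n) F u) (hF : Integrable F volume) (k : Fin 3 → ℤ)
    {t : ℝ} (ht : t ∈ Icc 0 T) :
    HasDerivWithinAt (modeRep W₁ n 𝔹 F u k)
      (-(((4 * Real.pi ^ 2 : ℝ) : ℂ) • transversalProj k (Torus.symbT (Torus.majorTranspose 𝔹) k (modeRep W₁ n 𝔹 F u k t))) -
        ∑ j, linkCoeff W₁ n k j t • transversalProj k
          ((Complex.exp ((W₁.phase j).φ * Complex.I) * (1 / (2 * ((2 * Real.pi * ‖latticeVec (W₁.phase j).m‖ : ℝ) : ℂ) * Complex.I))) •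
              modeRep W₁ n 𝔹 F u (k - fun i => (W₁.phase j).m i * n) t +
            (starRingEnd ℂ (Complex.exp ((W₁.phase j).φ * Complex.I)) *
                (-(1 / (2 * ((2 * Real.pi * ‖latticeVec (W₁.phase j).m‖ : ℝ) : ℂ) * Complex.I)))) •
              modeRep W₁ n 𝔹 F u (k + fun i => (W₁.phase j).m i * n) t)) (Icc 0 T) t := by
  have hT : 0 ≤ T := ht.1.trans ht.2
  set R : ℝ → EuclideanSpace ℂ (Fin 3) := fun τ =>
      (-(((4 * Real.pi ^ 2 : ℝ) : ℂ) • transversalProj k (Torus.symbT (Torus.majorTranspose 𝔹) k (modeRep W₁ n 𝔹 F u k τ))) -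
        ∑ j, linkCoeff W₁ n k j τ • transversalProj k
          ((Complex.exp ((W₁.phase j).φ * Complex.I) * (1 / (2 * ((2 * Real.pi * ‖latticeVec (W₁.phase j).m‖ : ℝ) : ℂ) * Complex.I))) •
              modeRep W₁ n 𝔹 F u (k - fun i => (W₁.phase j).m i * n) τ +
            (starRingEnd ℂ (Complex.exp ((W₁.phase j).φ * Complex.I)) *
                (-(1 / (2 * ((2 * Real.pi * ‖latticeVec (W₁.phase j).m‖ : ℝ) : ℂ) * Complex.I)))) •
              modeRep W₁ n 𝔹 F u (k + fun i => (W₁.phase j).m i * n) τ)) with hR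
  have hRc : ContinuousOn R (Icc 0 T) := continuousOn_repRHS W₁ n hT h k
  haveI : Fact (t ∈ Icc 0 T) := ⟨ht⟩
  have hint : IntervalIntegrable R volume 0 t :=
    (hRc.mono (by rw [uIcc_of_le ht.1]; exact Icc_subset_Icc_right ht.2)).intervalIntegrable
  have hmeas : StronglyMeasurableAtFilter R (𝓝[Icc 0 T] t) volume :=
    hRc.stronglyMeasurableAtFilter_nhdsWithin measurableSet_Icc t
  have hcont : ContinuousWithinAt R (Icc 0 T) t := hRc t ht
  have hG : HasDerivWithinAt (fun s => transversalProj k (mFourierCoeff (EuclideanSpace.complexify ∘ F) k) + ∫ τ in (0:ℝ)..s, R τ)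
      (R t) (Icc 0 T) t :=
    (intervalIntegral.integral_hasDerivWithinAt_right hint hmeas hcont).const_add _
  refine hG.congr (fun s hs => ?_) ?_
  · exact modeRep_eq_integral_rep W₁ n hT h hF k hs
  · exact modeRep_eq_integral_rep W₁ n hT h hF k ht

/-! ## §3 Classical derivatives of norms and pairings of the representatives -/

/-- **Derivative of a squared mode amplitude**: on `(0,T)`, `(‖modeRep k‖²)' = 2·Re⟪modeRep k t, (representative right-hand side) t⟫`.
[cite: Temam1984, Ch. III §1.1] -/
theorem hasDerivAt_norm_sq_modeRep (W₁ : LatticeWord k₀) (n : ℕ) {T : ℝ} {𝔹 : Torus.Visc4 (Fin 3)}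
    {F : UnitAddTorus (Fin 3) → EuclideanSpace ℝ (Fin 3)} {u : ℝ → UnitAddTorus (Fin 3) → EuclideanSpace ℝ (Fin 3)}
    (h : Torus.IsWeakTensorPassiveVectorOn 0 T 𝔹 (W₁.cell n) F u) (hF : Integrable F volume) (k : Fin 3 → ℤ)
    {t : ℝ} (ht : t ∈ Ioo 0 T) :
    HasDerivAt (fun s => ‖modeRep W₁ n 𝔹 F u k s‖ ^ 2)
      (2 * (⟪modeRep W₁ n 𝔹 F u k t,
        (-(((4 * Real.pi ^ 2 : ℝ) : ℂ) • transversalProj k (Torus.symbT (Torus.majorTranspose 𝔹) k (modeRep W₁ n 𝔹 F u k t))) -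
        ∑ j, linkCoeff W₁ n k j t • transversalProj k
          ((Complex.exp ((W₁.phase j).φ * Complex.I) * (1 / (2 * ((2 * Real.pi * ‖latticeVec (W₁.phase j).m‖ : ℝ) : ℂ) * Complex.I))) •
              modeRep W₁ n 𝔹 F u (k - fun i => (W₁.phase j).m i * n) t +
            (starRingEnd ℂ (Complex.exp ((W₁.phase j).φ * Complex.I)) *
                (-(1 / (2 * ((2 * Real.pi * ‖latticeVec (W₁.phase j).m‖ : ℝ) : ℂ) * Complex.I)))) •
              modeRep W₁ n 𝔹 F u (k + fun i => (W₁.phase j).m i * n) t))⟫_ℂ).re) t := by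
  have hd := hasDerivAt_modeRep W₁ n h hF k ht
  have h2 := hd.norm_sq
  have h3 : ∀ y : EuclideanSpace ℂ (Fin 3), ⟪modeRep W₁ n 𝔹 F u k t, y⟫_ℝ = (⟪modeRep W₁ n 𝔹 F u k t, y⟫_ℂ).re :=
    fun y => real_inner_eq_re_inner ℂ (modeRep W₁ n 𝔹 F u k t) y
  rwa [h3] at h2

/-- **Derivative of the real pairing of two representatives**: on `(0,T)`,
`(Re⟪modeRep k, modeRep k'⟫)' = Re⟪modeRep k t, rhs(k') t⟫ + Re⟪rhs(k) t, modeRep k' t⟫`. [cite: Temam1984, Ch. III §1.1] -/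
theorem hasDerivAt_re_inner_modeRep (W₁ : LatticeWord k₀) (n : ℕ) {T : ℝ} {𝔹 : Torus.Visc4 (Fin 3)}
    {F : UnitAddTorus (Fin 3) → EuclideanSpace ℝ (Fin 3)} {u : ℝ → UnitAddTorus (Fin 3) → EuclideanSpace ℝ (Fin 3)}
    (h : Torus.IsWeakTensorPassiveVectorOn 0 T 𝔹 (W₁.cell n) F u) (hF : Integrable F volume) (k k' : Fin 3 → ℤ)
    {t : ℝ} (ht : t ∈ Ioo 0 T) :
    HasDerivAt (fun s => (⟪modeRep W₁ n 𝔹 F u k s, modeRep W₁ n 𝔹 F u k' s⟫_ℂ).re)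
      ((⟪modeRep W₁ n 𝔹 F u k t,
        (-(((4 * Real.pi ^ 2 : ℝ) : ℂ) • transversalProj k' (Torus.symbT (Torus.majorTranspose 𝔹) k' (modeRep W₁ n 𝔹 F u k' t))) -
        ∑ j, linkCoeff W₁ n k' j t • transversalProj k'
          ((Complex.exp ((W₁.phase j).φ * Complex.I) * (1 / (2 * ((2 * Real.pi * ‖latticeVec (W₁.phase j).m‖ : ℝ) : ℂ) * Complex.I))) •
              modeRep W₁ n 𝔹 F u (k' - fun i => (W₁.phase j).m i * n) t +
            (starRingEnd ℂ (Complex.exp ((W₁.phase j).φ * Complex.I)) *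
                (-(1 / (2 * ((2 * Real.pi * ‖latticeVec (W₁.phase j).m‖ : ℝ) : ℂ) * Complex.I)))) •
              modeRep W₁ n 𝔹 F u (k' + fun i => (W₁.phase j).m i * n) t))⟫_ℂ).re +
       (⟪(-(((4 * Real.pi ^ 2 : ℝ) : ℂ) • transversalProj k (Torus.symbT (Torus.majorTranspose 𝔹) k (modeRep W₁ n 𝔹 F u k t))) -
        ∑ j, linkCoeff W₁ n k j t • transversalProj k
          ((Complex.exp ((W₁.phase j).φ * Complex.I) * (1 / (2 * ((2 * Real.pi * ‖latticeVec (W₁.phase j).m‖ : ℝ) : ℂ) * Complex.I))) •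
              modeRep W₁ n 𝔹 F u (k - fun i => (W₁.phase j).m i * n) t +
            (starRingEnd ℂ (Complex.exp ((W₁.phase j).φ * Complex.I)) *
                (-(1 / (2 * ((2 * Real.pi * ‖latticeVec (W₁.phase j).m‖ : ℝ) : ℂ) * Complex.I)))) •
              modeRep W₁ n 𝔹 F u (k + fun i => (W₁.phase j).m i * n) t)), modeRep W₁ n 𝔹 F u k' t⟫_ℂ).re) t := by
  have hd := hasDerivAt_modeRep W₁ n h hF k ht
  have hd' := hasDerivAt_modeRep W₁ n h hF k' ht
  have hi := hd.inner ℂ hd'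
  have hre := Complex.reCLM.hasFDerivAt.comp_hasDerivAt t hi
  simpa only [Function.comp_def, Complex.reCLM_apply, Complex.add_re] using hre

end Summit.AnomalousDissipation.AnomalousDissipation.Theorems.SolenoidalFractalHomogenisation.LagrangianStep.CellChain

end
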